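import Mathlib
import Literature.Analysis.FluidPDE.HardSphereCollisionRecord
import Literature.Analysis.FluidPDE.HardSphereAlexander
import Literature.MathematicalPhysics.KineticTheory.HardSphereEuler
import Literature.MathematicalPhysics.KineticTheory.HardSphereEulerProofs
import Literature.MathematicalPhysics.KineticTheory.HardSphereUniformGas
import Summits.AtomisticToContinuum.HydrodynamicLimit.Theorems.OneFlightGossipEngineOneFlightLayeredChaosFirstFlightVelInput
import Summits.AtomisticToContinuum.HydrodynamicLimit.Theorems.OneFlightGossipEngineOneFlightLayeredChaosFirstFlightGhostInput
import HarnessLib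

/-!
# `OneFlightGossipEngine.OneFlightLayeredChaos` — ghost-environment identification of the first-flight event, III: transfer
(crux stmt-AtomisticToContinuum-14535, line `Sketch`, reduction R2 of the first rung `stub_firstFlight_velInput`;
registered stub `firstFlightVelInput_of_ghostInput`; stub worker of lead cycle c3, wave 3, 2026-08-17).

* `ae_comp_emb_mem_good` — for every law `P ≪ Liouville` of `N + 1` spheres and every hard-sphere flow `Ψ` of `m`
  spheres, `z ∘ emb` is `Ψ`-good for `P`-a.e. `z` (the `emb`-marginal of Lebesgue measure does not charge Lebesgue-null
  sets, `volume_setOf_comp_emb_null`).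
* `firstFlightVelInput_of_ghostInput` (registered) — `FirstFlightGhostInput θ₀ → FirstFlightVelInput θ₀`. For a flow
  `Φ` of the `N + 1` spheres and a pair `j ≠ i`, enumerate the other labels by `emb` (`Finset.orderEmbOfFin` of
  `{i, j}ᶜ`) and take any hard-sphere flow `Ψ` of the `N − 1` others (Alexander's theorem on `𝕋³`,
  `HardSphereFlow.nonempty_torus_holds`, `ε < 1/2` for `σ < 1/2`). The product law `(μ ⊗ γ) ∘ zipConfig⁻¹` is the
  local Gibbs law (`localGibbsMeasure_rung0_eq_map`), absolutely continuous with respect to Liouville, so the datum is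
  `Φ`-good with `Ψ`-good ghost part almost surely (`ae_comp_emb_mem_good`); on such data the first-flight event IS the
  ghost event and the two contact normals agree (`firstFlightEvent_subset_ghost`, `firstFlight_of_ghost`). By Tonelli
  (`Measure.prod_apply_symm`) the exceptional data have `μ`-null `v`-sections for `γ`-a.e. `v`; there the two pairs of
  `μ`-events of the inputs coincide up to null sets, and on the `γ`-null exceptional set of `v` the defect is at most
  `1` (probability measure, flux functional in `[0, 1]`), so the weight `b' := b` resp. `1` (`=ᵐ b`) does it.
-/

open scoped BigOperators ENNReal Topology
open MeasureTheory Set Filter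
open Literature.Analysis.FluidPDE Literature.MathematicalPhysics.KineticTheory
open Summit.AtomisticToContinuum.HydrodynamicLimit.Theorems

namespace Summit.AtomisticToContinuum.HydrodynamicLimit.Theorems.OLC

noncomputable section

/-! ## The ghost part of almost every datum is good -/

section AlmostGood

/-- **A coordinate restriction of Lebesgue measure does not charge Lebesgue-null sets**: for an embedding
`emb : Fin m ↪ Fin n` and a null set `A` of `Fin m → α` (`α` σ-finite), `{z : Fin n → α | z ∘ emb ∈ A}` is null
(split the coordinates into `range emb` and its complement, `MeasurableEquiv.piEquivPiSubtypeProd`: the set is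
`(A' × univ)` with `A'` a relabelling of `A`). [folklore] -/
theorem volume_setOf_comp_emb_null {α : Type*} [MeasureSpace α] [SigmaFinite (volume : Measure α)] {m n : ℕ}
    (emb : Fin m ↪ Fin n) {A : Set (Fin m → α)} (hA : volume A = 0) :
    volume {z : Fin n → α | (z ∘ emb : Fin m → α) ∈ A} = 0 := by
  classical
  set p : Fin n → Prop := fun k => ∃ l, emb l = k with hp
  set e := MeasurableEquiv.piEquivPiSubtypeProd (fun _ : Fin n => α) p with hedef
  have he : MeasurePreserving e volume volume := volume_preserving_piEquivPiSubtypeProd (fun _ : Fin n => α) p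
  set eq : Fin m ≃ {k // p k} := Equiv.ofInjective emb emb.injective with heqdef
  set g := MeasurableEquiv.piCongrLeft (fun _ : Fin m => α) eq.symm with hgdef
  have hg : MeasurePreserving g volume volume := volume_measurePreserving_piCongrLeft (fun _ : Fin m => α) eq.symm
  have hgap : ∀ z : Fin n → α, g (fun x : {k // p k} => z x) = (z ∘ emb : Fin m → α) := by
    intro z
    funext b
    simp only [hgdef, MeasurableEquiv.coe_piCongrLeft, Equiv.piCongrLeft_apply_eq_cast, cast_eq, Equiv.symm_symm,
      Function.comp_apply]
    rfl
  have hset : {z : Fin n → α | (z ∘ emb : Fin m → α) ∈ A} = e ⁻¹' ((g ⁻¹' A) ×ˢ Set.univ) := by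
    ext z
    show (z ∘ emb : Fin m → α) ∈ A ↔
      ((fun x : {k // p k} => z x, fun x : {k // ¬ p k} => z x) ∈ (g ⁻¹' A) ×ˢ (Set.univ : Set ({k // ¬ p k} → α)))
    rw [Set.mem_prod, Set.mem_preimage, hgap z]
    simp
  rw [hset]
  refine he.preimage_null ?_
  rw [Measure.volume_eq_prod, Measure.prod_prod, hg.preimage_null hA, zero_mul]

variable {σ : ℝ} {N m : ℕ}

/-- **The ghost part of almost every datum is good**: for every law `P` of `N + 1` spheres absolutely continuous with
respect to the Liouville measure (e.g. the local Gibbs laws) and every hard-sphere flow `Ψ` of `m` spheres, the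
restriction `z ∘ emb` is `Ψ`-good for `P`-a.e. `z` (`Ψ.good` is Liouville-conull, the restriction of a configuration of
the hard-sphere domain lies in the hard-sphere domain, and `volume_setOf_comp_emb_null`). [folklore] -/
theorem ae_comp_emb_mem_good (Ψ : HardSphereFlow (Torus.geometry (Fin 3)) (hsDiameter σ N) m)
    (emb : Fin m ↪ Fin (N + 1)) {P : Measure (Config (N + 1) (Fin 3) T3)}
    (hP : P ≪ liouville (Torus.geometry (Fin 3)) (N + 1) (hsDiameter σ N)) :
    ∀ᵐ z ∂P, (z ∘ emb : Config m (Fin 3) T3) ∈ Ψ.good := by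
  have hA : volume (Ψ.goodᶜ ∩ hardSphereDomain (Torus.geometry (Fin 3)) m (hsDiameter σ N)) = 0 := by
    rw [← Measure.restrict_apply Ψ.measurableSet_good.compl, ← liouville_eq]
    exact Ψ.measure_compl_good
  have hL : ∀ᵐ z ∂(liouville (Torus.geometry (Fin 3)) (N + 1) (hsDiameter σ N)),
      (z ∘ emb : Config m (Fin 3) T3) ∈ Ψ.good := by
    rw [liouville_eq, ae_restrict_iff' (measurableSet_hardSphereDomain _ Torus.measurable_geometry_sepVec _ _),
      ae_iff]
    refine measure_mono_null (fun z hz => ?_) (volume_setOf_comp_emb_null emb hA)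
    have hz' : ¬ (z ∈ hardSphereDomain (Torus.geometry (Fin 3)) (N + 1) (hsDiameter σ N) →
        (z ∘ emb : Config m (Fin 3) T3) ∈ Ψ.good) := hz
    push Not at hz'
    exact ⟨hz'.2, comp_emb_mem_hardSphereDomain emb hz'.1⟩
  exact hP.ae_le hL

end AlmostGood

/-! ## The transfer -/

/-- An enumeration of the labels other than a pair `i ≠ j` of `Fin (N + 1)` by `Fin (N - 1)`. [folklore] -/
theorem exists_emb_compl_pair {N : ℕ} {i j : Fin (N + 1)} (hij : i ≠ j) :
    ∃ emb : Fin (N - 1) ↪ Fin (N + 1), ∀ k : Fin (N + 1), (∃ l, emb l = k) ↔ (k ≠ i ∧ k ≠ j) := by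
  classical
  have hcard : (({i, j} : Finset (Fin (N + 1)))ᶜ).card = N - 1 := by
    rw [Finset.card_compl, Finset.card_pair hij, Fintype.card_fin]
    omega
  refine ⟨(({i, j} : Finset (Fin (N + 1)))ᶜ.orderEmbOfFin hcard).toEmbedding, fun k => ?_⟩
  have hrange : k ∈ Set.range (({i, j} : Finset (Fin (N + 1)))ᶜ.orderEmbOfFin hcard) ↔
      k ∈ ((({i, j} : Finset (Fin (N + 1)))ᶜ : Finset (Fin (N + 1))) : Set (Fin (N + 1))) := by
    rw [Finset.range_orderEmbOfFin]
  rw [Finset.mem_coe, Finset.mem_compl, Finset.mem_insert, Finset.mem_singleton, not_or] at hrange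
  exact hrange

/-- `|a − f c| ≤ 1` for `a, c, f ∈ [0, 1]`. [folklore] -/
theorem abs_sub_mul_le_one {a f c : ℝ} (ha0 : 0 ≤ a) (ha1 : a ≤ 1) (hf0 : 0 ≤ f) (hf1 : f ≤ 1) (hc0 : 0 ≤ c)
    (hc1 : c ≤ 1) : |a - f * c| ≤ 1 := by
  rw [abs_sub_le_iff]
  constructor <;> nlinarith

/-- **The ghost input implies the velocity-fibre input** (`FirstFlightGhostInput θ₀ → FirstFlightVelInput θ₀`): the
first-flight event of the pair and the ghost event, as well as the two contact normals, coincide for almost every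
datum (good for the `(N+1)`-body flow, ghost part good for the ghost flow — an absolutely continuous law does not see
the difference), so for `γ`-a.e. frozen velocity `v` the two pairs of `μ`-events have the same measures; on the
exceptional `γ`-null set of `v` the defect is at most `1`. [folklore] -/
theorem firstFlightVelInput_of_ghostInput : ∀ {θ₀ : ℝ}, 0 < θ₀ → Summit.AtomisticToContinuum.HydrodynamicLimit.Theorems.OLC.FirstFlightGhostInput θ₀ → Summit.AtomisticToContinuum.HydrodynamicLimit.Theorems.OLC.FirstFlightVelInput θ₀ := by
  intro θ₀ hθ h
  obtain ⟨C, hC, p, hp, σ₀, hσ₀, H⟩ := h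
  refine ⟨C, hC, p, hp, min σ₀ 2⁻¹, lt_min hσ₀ (by norm_num), fun σ hσ hσlt => ?_⟩
  have hσ₀' : σ < σ₀ := hσlt.trans_le (min_le_left _ _)
  have hσ2 : σ < 2⁻¹ := hσlt.trans_le (min_le_right _ _)
  intro τ hτ
  obtain ⟨N₀, hN₀⟩ := H σ hσ hσ₀' τ hτ
  refine ⟨N₀, fun N hN Φ i j hji => ?_⟩
  intro G ε w q μ γ t₀ F ωPair flux
  -- a ghost flow of the other `N − 1` spheres and an enumeration of their labels
  have hε : 0 < ε := hsDiameter_pos hσ N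
  have hε2 : ε < 2⁻¹ := (hsDiameter_le hσ.le N).trans_lt hσ2
  obtain ⟨Ψ⟩ := HardSphereFlow.nonempty_torus_holds (d := Fin 3) hε hε2 (N - 1)
  obtain ⟨emb, hemb⟩ := exists_emb_compl_pair (N := N) hji.symm
  obtain ⟨b, hbi, hbint, hbv⟩ := hN₀ N hN Ψ i j hji emb hemb
  -- the ghost-side objects
  set Fg : Set (Config (N + 1) (Fin 3) T3) := firstFlightGhostEvent Ψ i j emb w with hFgdef
  set ωG : Config (N + 1) (Fin 3) T3 → V3 := fun z =>
    ε⁻¹ • G.sepVec (freeFlight G (freeEntranceTime ε z i j) z i).1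
      (freeFlight G (freeEntranceTime ε z i j) z j).1 with hωGdef
  -- the product law does not see the bad data
  haveI : IsProbabilityMeasure μ :=
    isProbabilityMeasure_posGibbsMeasure continuous_const (fun _ => one_pos) (by linarith : σ ≤ 1 / 2) N
  set P : Measure (Config (N + 1) (Fin 3) T3) := (μ.prod γ).map zipConfig with hPdef
  have hPeq : P = localGibbsMeasure σ (fun _ => 1) (fun _ => 0) (fun _ => θ₀) N :=
    (localGibbsMeasure_rung0_eq_map σ zero_le_one hθ (0 : V3) N).symm
  have hPac : P ≪ liouville G (N + 1) ε := by
    rw [hPeq]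
    exact localGibbsMeasure_absolutelyContinuous σ _ _ _ N Φ
  set Gd : Set (Config (N + 1) (Fin 3) T3) :=
    Φ.good ∩ {z | (z ∘ emb : Config (N - 1) (Fin 3) T3) ∈ Ψ.good} with hGddef
  have hGdm : MeasurableSet Gd := Φ.measurableSet_good.inter ((measurable_comp_emb emb) Ψ.measurableSet_good)
  have hPGd : P Gdᶜ = 0 := by
    have h1 : ∀ᵐ z ∂P, z ∈ Φ.good := by
      have : P Φ.goodᶜ = 0 := hPac Φ.measure_compl_good
      exact mem_ae_iff.2 this
    have h2 : ∀ᵐ z ∂P, (z ∘ emb : Config (N - 1) (Fin 3) T3) ∈ Ψ.good := ae_comp_emb_mem_good Ψ emb hPac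
    have h3 : ∀ᵐ z ∂P, z ∈ Gd := by
      filter_upwards [h1, h2] with z hz hz' using ⟨hz, hz'⟩
    exact mem_ae_iff.1 h3
  -- for `γ`-a.e. `v` the bad `v`-section is `μ`-null
  set Sv : (Fin (N + 1) → V3) → Set (Fin (N + 1) → T3) := fun v => {x | zipConfig (x, v) ∉ Gd} with hSvdef
  have hae : ∀ᵐ v ∂γ, μ (Sv v) = 0 := by
    have hprod : (μ.prod γ) (zipConfig ⁻¹' Gdᶜ) = 0 := by
      rw [← Measure.map_apply measurable_zipConfig hGdm.compl]
      exact hPGd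
    rw [Measure.prod_apply_symm (measurable_zipConfig hGdm.compl)] at hprod
    have h0 := (lintegral_eq_zero_iff (measurable_measure_prodMk_right (measurable_zipConfig hGdm.compl))).1 hprod
    filter_upwards [h0] with v hv
    exact hv
  -- on good data the two events and the two normals coincide
  have hcore : ∀ z ∈ Gd, (z ∈ F ↔ z ∈ Fg) ∧ (z ∈ F → ωPair z = ωG z) := by
    intro z hzG
    obtain ⟨hz, hzm⟩ := hzG
    have hzm' : (z ∘ emb : Config (N - 1) (Fin 3) T3) ∈ Ψ.good := hzm
    have hFG : z ∈ F → z ∈ Fg ∧ ωPair z = ωG z := by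
      rintro ⟨-, ht, hj, hfresh⟩
      have ht' : Φ.nthCollisionTimeOf i 0 z ∈ Set.Ioc 0 w := ht
      obtain ⟨htE₀, hav⟩ := firstFlightEvent_subset_ghost Φ Ψ emb hemb hz hzm' ht'.1 hj hfresh
      have htE : freeEntranceTime ε z i j = Φ.nthCollisionTimeOf i 0 z := htE₀
      refine ⟨⟨hzm', ?_, ?_⟩, ?_⟩
      · rw [htE]
        exact ht'
      · rw [htE]
        exact hav
      · show ε⁻¹ • G.sepVec (freeFlight G (Φ.nthCollisionTimeOf i 0 z) z i).1
            (freeFlight G (Φ.nthCollisionTimeOf i 0 z) z j).1 =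
          ε⁻¹ • G.sepVec (freeFlight G (freeEntranceTime ε z i j) z i).1 (freeFlight G (freeEntranceTime ε z i j) z j).1
        rw [htE]
    refine ⟨⟨fun hF => (hFG hF).1, ?_⟩, fun hF => (hFG hF).2⟩
    rintro ⟨-, htw, hav⟩
    obtain ⟨ht₀, hj, hfree⟩ := firstFlight_of_ghost Φ Ψ emb hji.symm hemb hz hzm' htw.1 hav
    refine ⟨hz, ?_, hj, fun u hu => ?_⟩
    · show Φ.nthCollisionTimeOf i 0 z ∈ Set.Ioc 0 w
      rw [ht₀]
      exact htw
    · have hu' : u ∈ Set.Ioo 0 (Φ.nthCollisionTimeOf i 0 z) := hu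
      rw [ht₀] at hu'
      exact (hfree u hu').2
  -- the new weight
  set b' : (Fin (N + 1) → V3) → ℝ := fun v => if μ (Sv v) = 0 then b v else 1 with hb'def
  have hbb' : b' =ᵐ[γ] b := by
    filter_upwards [hae] with v hv
    simp only [hb'def, hv, if_true]
  refine ⟨b', hbi.congr hbb'.symm, ?_, fun v U hU T hT => ?_⟩
  · rw [integral_congr_ae hbb']
    exact hbint
  by_cases hv : μ (Sv v) = 0
  · -- typical `v`: the events agree up to the `μ`-null section
    have hb'v : b' v = b v := by simp only [hb'def, hv, if_true]
    rw [hb'v]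
    have hnot : ∀ᵐ x ∂μ, x ∉ Sv v := measure_eq_zero_iff_ae_notMem.1 hv
    have key : |(μ {x | zipConfig (x, v) ∈ Fg ∧ ωG (zipConfig (x, v)) ∈ U ∧ (fun k => q (x k)) ∈ T}).toReal -
        flux (‖v i - v j‖⁻¹ • (v i - v j)) U *
          (μ {x | zipConfig (x, v) ∈ Fg ∧ (fun k => q (x k)) ∈ T}).toReal| ≤ b v :=
      hbv v U hU T hT
    have e1 : μ {x | zipConfig (x, v) ∈ F ∧ ωPair (zipConfig (x, v)) ∈ U ∧ (fun k => q (x k)) ∈ T} =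
        μ {x | zipConfig (x, v) ∈ Fg ∧ ωG (zipConfig (x, v)) ∈ U ∧ (fun k => q (x k)) ∈ T} := by
      refine measure_congr ?_
      filter_upwards [hnot] with x hx
      have hzG : zipConfig (x, v) ∈ Gd := not_not.1 hx
      obtain ⟨hiff, hω⟩ := hcore _ hzG
      refine propext ⟨?_, ?_⟩
      · rintro ⟨hF, hU', hT'⟩
        exact ⟨hiff.1 hF, (hω hF) ▸ hU', hT'⟩
      · rintro ⟨hF, hU', hT'⟩
        have hF' : zipConfig (x, v) ∈ F := hiff.2 hF
        exact ⟨hF', (hω hF').symm ▸ hU', hT'⟩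
    have e2 : μ {x | zipConfig (x, v) ∈ F ∧ (fun k => q (x k)) ∈ T} =
        μ {x | zipConfig (x, v) ∈ Fg ∧ (fun k => q (x k)) ∈ T} := by
      refine measure_congr ?_
      filter_upwards [hnot] with x hx
      have hzG : zipConfig (x, v) ∈ Gd := not_not.1 hx
      obtain ⟨hiff, -⟩ := hcore _ hzG
      refine propext ⟨?_, ?_⟩
      · rintro ⟨hF, hT'⟩
        exact ⟨hiff.1 hF, hT'⟩
      · rintro ⟨hF, hT'⟩
        exact ⟨hiff.2 hF, hT'⟩
    rw [e1, e2]
    exact key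
  · -- exceptional `v`: the trivial bound
    have hb'v : b' v = 1 := by simp only [hb'def, hv, if_false]
    rw [hb'v]
    have hm : ∀ s : Set (Fin (N + 1) → T3), (μ s).toReal ≤ 1 := fun s => by
      have := ENNReal.toReal_mono ENNReal.one_ne_top (prob_le_one (μ := μ) (s := s))
      rwa [ENNReal.toReal_one] at this
    have hf := fluxFn_mem_Icc (‖v i - v j‖⁻¹ • (v i - v j)) U
    exact abs_sub_mul_le_one ENNReal.toReal_nonneg (hm _) hf.1 hf.2 ENNReal.toReal_nonneg (hm _)

end

end Summit.AtomisticToContinuum.HydrodynamicLimit.Theorems.OLC
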